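import Mathlib.GroupTheory.SpecificGroups.Cyclic
import Mathlib.GroupTheory.IndexNormal
import Mathlib.Data.Nat.Prime.Basic
import Mathlib.RingTheory.Coprime.Basic
import Mathlib.Tactic.Group
import Mathlib.Tactic.Ring
import Mathlib.Tactic.IntervalCases
import HarnessLib

/-!
# A `2`-group with a UNIQUE INVOLUTION and a CYCLIC subgroup of index two is cyclic or generalised quaternion

COR-CM (cell `pub-hodgecm2`), binder seat b04 (gen 34), count-neutral own lane «Galois-CM-type classification».  KERNEL ONLY,
Mathlib only: theorems; no definition, no named fact, no `sorry`.  First half of the classical theorem «a finite `2`-group with a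
unique element of order `2` is cyclic or generalised quaternion» [Rotman1995, Thm. 5.46], namely the case of a group `G` of order
`2^(m+1)` containing an element `a` of order `2^m` [Rotman1995, Cor. 5.45]: writing `x ∉ ⟨a⟩`, `x a x⁻¹ = aʳ`, `x² ∈ ⟨a⟩`, one has
`r² ≡ 1 (mod 2^m)`, hence (`§1`) `x a x⁻¹ ∈ {a, a z, a⁻¹, a⁻¹ z}` with `z = a^(2^(m-1))` the involution of `⟨a⟩`; the cases `a z`,
`a⁻¹ z` and `a⁻¹` with `x² = 1` produce a second involution outside `⟨a⟩`, the case `a` gives a cyclic group or a second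
involution, and the case `a⁻¹`, `x² = z` is the generalised quaternion group `Q_{2^(m+1)}` — identified with Mathlib's
`QuaternionGroup (2^(m-1))` (`a i ↦ aⁱ`, `xa i ↦ x aⁱ`) in the companion `CorCM/TwoGroupQuaternionRelations`.  The second half
(induction over a subgroup of index two; the case of a generalised quaternion subgroup of index two) is
`CorCM/TwoGroupUniqueInvolution`; the consumer is
`CorCM/GaloisMinimalTwoPowerClassification` (gen 34): a GOOD Galois CM field of `2`-power degree `≥ 64` WITHOUT proper Galois CM
subfield has cyclic or generalised quaternion Galois group (and conversely such fields are GOOD — `CorCM/CyclicTwoPowerCMTypes`,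
`CorCM/GaloisDicyclicNondegenerate`).

* `two_pow_dvd_or_of_sq_modEq_one` — `r² ≡ 1 (mod 2^m)`, `1 ≤ m` ⟹ `2^(m-1) ∣ r - 1` or `2^(m-1) ∣ r + 1`.
* `conj_eq_or_of_orderOf_eq_two_pow` — `orderOf a = 2^m` (`1 ≤ m`), `x a x⁻¹ = aʳ`, `a^(r²) = a` ⟹
  `x a x⁻¹ = a ∨ x a x⁻¹ = a⁻¹ ∨ (3 ≤ m ∧ (x a x⁻¹ = a z ∨ x a x⁻¹ = a⁻¹ z))`.
* `isCyclic_or_exists_relations_of_orderOf_eq_two_pow` — THE CORE: `|G| = 2^(m+1)`, `orderOf a = 2^m`, `1 ≤ m`, at most one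
  involution ⟹ `G` is cyclic, or `2 ≤ m` and some `x ∉ ⟨a⟩` has `x a x⁻¹ = a⁻¹`, `x² = a^(2^(m-1))`.

## References

* [Rotman1995] J. J. Rotman, *An Introduction to the Theory of Groups*, 4th ed., GTM 148, Springer 1995, Thm. 5.44, Cor. 5.45,
  Thm. 5.46.

Provenance: Literature home (family `hodge`, namespace `Literature.GroupTheory.UniqueInvolution`) of the Summits-side `CorCM/TwoGroupCyclicIndexTwoUniqueInvolution` (cell `pub-hodgecm2`, COR-CM; all its imports are `Literature/` and Mathlib), which `Literature/` may not import; theorems only, no named fact, no definition. Nothing here bears on `HC_CM`. Lane `lit-hodgefound` (Layer A3: CM types, their Kubota ranks and Galois combinatorics), seat p20.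
-/

namespace Literature.GroupTheory.UniqueInvolution

variable {G : Type*} [Group G]

/-! ## §1 Arithmetic: square roots of `1` modulo `2^m`, and the four possible conjugation actions -/

/-- `r² ≡ 1 (mod 2^m)` with `1 ≤ m` forces `2^(m-1) ∣ r - 1` or `2^(m-1) ∣ r + 1`, i.e. `r ≡ ±1` or `r ≡ 2^(m-1) ± 1 (mod 2^m)`.
[cite: Rotman1995, Thm. 5.44 and Cor. 5.45] -/
theorem two_pow_dvd_or_of_sq_modEq_one {r m : ℕ} (hm : 1 ≤ m) (h : r * r ≡ 1 [MOD 2 ^ m]) :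
    2 ^ (m - 1) ∣ r - 1 ∨ 2 ^ (m - 1) ∣ r + 1 := by
  have h2 : r * r ≡ 1 [MOD 2] := h.of_dvd (dvd_pow_self 2 (by omega))
  have hrr : Odd (r * r) := Nat.odd_iff.2 h2
  obtain ⟨t, rfl⟩ := (Nat.odd_mul.1 hrr).1
  rcases Nat.lt_or_ge m 2 with hm1 | hm2
  · have : m = 1 := by omega
    subst this
    exact Or.inl (by simp)
  -- `2^m ∣ (2t+1)² - 1 = 4 t (t+1)`
  have hdvd : 2 ^ m ∣ (2 * t + 1) * (2 * t + 1) - 1 := (Nat.modEq_iff_dvd' (Nat.succ_le_of_lt (Nat.mul_pos (by omega) (by omega)))).1 h.symm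
  have hsq : (2 * t + 1) * (2 * t + 1) - 1 = 4 * (t * (t + 1)) := by
    have : (2 * t + 1) * (2 * t + 1) = 4 * (t * (t + 1)) + 1 := by ring
    omega
  rw [hsq] at hdvd
  have hpow : 2 ^ m = 4 * 2 ^ (m - 2) := by
    conv_lhs => rw [← Nat.sub_add_cancel hm2, pow_add]
    ring
  rw [hpow] at hdvd
  have hdvd' : 2 ^ (m - 2) ∣ t * (t + 1) := Nat.dvd_of_mul_dvd_mul_left (by norm_num) hdvd
  have hpow' : 2 ^ (m - 1) = 2 * 2 ^ (m - 2) := by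
    rw [show m - 1 = (m - 2) + 1 from by omega, pow_succ]
    ring
  rcases Nat.even_or_odd t with ht | ht
  · -- `t` even: `t + 1` odd, so `2^(m-2) ∣ t`
    have hodd : Odd (t + 1) := ht.add_one
    have hcop : Nat.Coprime (2 ^ (m - 2)) (t + 1) := Nat.Coprime.pow_left _ (Nat.coprime_two_left.2 hodd)
    have ht' : 2 ^ (m - 2) ∣ t := hcop.dvd_of_dvd_mul_right hdvd'
    left
    rw [show 2 * t + 1 - 1 = 2 * t from by omega, hpow']
    exact Nat.mul_dvd_mul_left 2 ht'
  · -- `t` odd: `2^(m-2) ∣ t + 1`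
    have hcop : Nat.Coprime (2 ^ (m - 2)) t := Nat.Coprime.pow_left _ (Nat.coprime_two_left.2 ht)
    have ht' : 2 ^ (m - 2) ∣ t + 1 := hcop.dvd_of_dvd_mul_left hdvd'
    right
    rw [show 2 * t + 1 + 1 = 2 * (t + 1) from by ring, hpow']
    exact Nat.mul_dvd_mul_left 2 ht'

/-- **The four possible actions.**  If `orderOf a = 2^m` (`1 ≤ m`), `x a x⁻¹ = aʳ` and `a^(r·r) = a` (which holds as soon as `x²`
commutes with `a`), then, with `z = a^(2^(m-1))` the involution of `⟨a⟩`: `x a x⁻¹ = a`, or `x a x⁻¹ = a⁻¹`, or `3 ≤ m` and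
`x a x⁻¹ ∈ {a z, a⁻¹ z}`. [cite: Rotman1995, Cor. 5.45] -/
theorem conj_eq_or_of_orderOf_eq_two_pow {a x : G} {m r : ℕ} (hm : 1 ≤ m) (ha : orderOf a = 2 ^ m)
    (hconj : x * a * x⁻¹ = a ^ r) (hrr : a ^ (r * r) = a) :
    x * a * x⁻¹ = a ∨ x * a * x⁻¹ = a⁻¹ ∨
      (3 ≤ m ∧ (x * a * x⁻¹ = a * a ^ (2 ^ (m - 1)) ∨ x * a * x⁻¹ = a⁻¹ * a ^ (2 ^ (m - 1)))) := by
  have h2m : 2 ≤ 2 ^ m := by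
    calc (2 : ℕ) = 2 ^ 1 := by norm_num
      _ ≤ 2 ^ m := Nat.pow_le_pow_right (by norm_num) hm
  have ha1 : a ≠ 1 := by
    intro h
    rw [h, orderOf_one] at ha
    omega
  have hxa1 : x * a * x⁻¹ ≠ 1 := by
    intro h
    rw [mul_inv_eq_one] at h
    exact ha1 (mul_left_cancel (a := x) (by rw [h, mul_one]))
  have hmod : r * r ≡ 1 [MOD 2 ^ m] := by
    rw [← ha, ← pow_eq_pow_iff_modEq, hrr, pow_one]
  have hz2 : a ^ (2 ^ (m - 1)) * a ^ (2 ^ (m - 1)) = 1 := by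
    rw [← pow_add, ← two_mul, ← pow_succ', show m - 1 + 1 = m from by omega, ← ha, pow_orderOf_eq_one]
  -- powers of `z`
  have hzpow : ∀ k : ℕ, a ^ (2 ^ (m - 1) * k) = 1 ∨ a ^ (2 ^ (m - 1) * k) = a ^ (2 ^ (m - 1)) := by
    intro k
    induction k with
    | zero => exact Or.inl (by rw [mul_zero, pow_zero])
    | succ k ih =>
      rw [mul_add, mul_one, pow_add]
      rcases ih with h | h
      · exact Or.inr (by rw [h, one_mul])
      · exact Or.inl (by rw [h, hz2])
  -- in the degenerate range `m = 2` the involution `z` is `a²` and `a z = a⁻¹`; for `m = 1`, `z = a`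
  have hsmall2 : m = 2 → a * a ^ (2 ^ (m - 1)) = a⁻¹ := by
    rintro rfl
    rw [eq_inv_iff_mul_eq_one]
    have h4 : a ^ 4 = 1 := by
      have := pow_orderOf_eq_one a
      rwa [ha] at this
    calc a * a ^ (2 ^ (2 - 1)) * a = a ^ 4 := by
          rw [show (2 : ℕ) ^ (2 - 1) = 2 from rfl]
          group
      _ = 1 := h4
  have hsmall1 : m = 1 → a ^ (2 ^ (m - 1)) = a := by
    rintro rfl
    simp
  rcases two_pow_dvd_or_of_sq_modEq_one hm hmod with ⟨k, hk⟩ | ⟨k, hk⟩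
  · -- `r = 1 + 2^(m-1) k`
    have hr1 : 1 ≤ r := by
      by_contra h0
      have hr0 : r = 0 := by omega
      rw [hr0, mul_zero, pow_zero] at hrr
      exact ha1 hrr.symm
    have hr : r = 1 + 2 ^ (m - 1) * k := by omega
    rw [hr, pow_add, pow_one] at hconj
    rcases hzpow k with h | h
    · exact Or.inl (by rw [hconj, h, mul_one])
    · rw [h] at hconj
      rcases Nat.lt_or_ge m 3 with hm3 | hm3
      · rcases (show m = 1 ∨ m = 2 by omega) with hm1 | hm2
        · -- `m = 1`: `x a x⁻¹ = a·a = 1`, impossible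
          exfalso
          refine hxa1 ?_
          rw [hconj, hsmall1 hm1]
          have hz2' := hz2
          rw [hsmall1 hm1] at hz2'
          exact hz2'
        · exact Or.inr (Or.inl (by rw [hconj, hsmall2 hm2]))
      · exact Or.inr (Or.inr ⟨hm3, Or.inl hconj⟩)
  · -- `r + 1 = 2^(m-1) k`, so `aʳ = a⁻¹ z^k`
    have hconj' : x * a * x⁻¹ = a⁻¹ * a ^ (2 ^ (m - 1) * k) := by
      rw [hconj, eq_inv_mul_iff_mul_eq, ← pow_succ', hk]
    rcases hzpow k with h | h
    · exact Or.inr (Or.inl (by rw [hconj', h, mul_one]))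
    · rw [h] at hconj'
      rcases Nat.lt_or_ge m 3 with hm3 | hm3
      · rcases (show m = 1 ∨ m = 2 by omega) with hm1 | hm2
        · -- `m = 1`: `x a x⁻¹ = a⁻¹ a = 1`, impossible
          exfalso
          refine hxa1 ?_
          rw [hconj', hsmall1 hm1, inv_mul_cancel]
        · -- `m = 2`: `a⁻¹ a² = a`
          left
          rw [hconj', hm2, show (2 : ℕ) ^ (2 - 1) = 2 from rfl, pow_two, inv_mul_cancel_left]
      · exact Or.inr (Or.inr ⟨hm3, Or.inr hconj'⟩)

/-! ## §2 The core: a cyclic subgroup of index two and at most one involution -/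

/-- **THE CORE** [Rotman1995, Cor. 5.45 and the last paragraph of the proof of Thm. 5.46].  Let `|G| = 2^(m+1)` (`1 ≤ m`), let
`a ∈ G` have order `2^m`, and suppose `G` has AT MOST ONE involution.  Then `G` is cyclic, or `2 ≤ m` and there is `x ∉ ⟨a⟩` with
`x a x⁻¹ = a⁻¹` and `x² = a^(2^(m-1))` (the defining relations of the generalised quaternion group `Q_{2^(m+1)}`).
[cite: Rotman1995, Cor. 5.45 and Thm. 5.46] -/
theorem isCyclic_or_exists_relations_of_orderOf_eq_two_pow [Finite G] {a : G} {m : ℕ} (hm : 1 ≤ m)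
    (hcard : Nat.card G = 2 ^ (m + 1)) (ha : orderOf a = 2 ^ m)
    (huniq : ∀ s t : G, s * s = 1 → s ≠ 1 → t * t = 1 → t ≠ 1 → s = t) :
    IsCyclic G ∨ (2 ≤ m ∧ ∃ x : G, x ∉ Subgroup.zpowers a ∧ x * a * x⁻¹ = a⁻¹ ∧ x * x = a ^ (2 ^ (m - 1))) := by
  classical
  set A := Subgroup.zpowers a with hA
  have hpos : 0 < 2 ^ m := by positivity
  have h2m : 2 ^ m = 2 * 2 ^ (m - 1) := by
    rw [← pow_succ', show m - 1 + 1 = m from by omega]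
  have hAcard : Nat.card A = 2 ^ m := by rw [hA, Nat.card_zpowers, ha]
  have hidx : A.index = 2 := by
    have h1 := A.index_mul_card
    rw [hAcard, hcard, pow_succ, mul_comm (2 ^ m) 2] at h1
    exact Nat.eq_of_mul_eq_mul_right hpos h1
  haveI hAn : A.Normal := Subgroup.normal_of_index_eq_two hidx
  -- powers of `a` killed by `2^m`
  have hapow : ∀ c : ℕ, a ^ (2 ^ m * c) = 1 := fun c => by
    rw [pow_mul, ← ha, pow_orderOf_eq_one, one_pow]
  -- `z`, the involution of `A`
  have hz2 : a ^ (2 ^ (m - 1)) * a ^ (2 ^ (m - 1)) = 1 := by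
    rw [← pow_add, ← two_mul, ← h2m, ← ha, pow_orderOf_eq_one]
  have hz1 : a ^ (2 ^ (m - 1)) ≠ 1 := by
    intro h
    have hd : orderOf a ∣ 2 ^ (m - 1) := orderOf_dvd_of_pow_eq_one h
    rw [ha] at hd
    have := Nat.le_of_dvd (by positivity) hd
    omega
  have hzA : a ^ (2 ^ (m - 1)) ∈ A := Subgroup.npow_mem_zpowers a _
  -- no involution outside `A`
  have hout : ∀ y : G, y ∉ A → y * y ≠ 1 := by
    intro y hyA hy
    have hy1 : y ≠ 1 := fun h => hyA (h ▸ A.one_mem)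
    exact hyA (huniq y _ hy hy1 hz2 hz1 ▸ hzA)
  -- a cyclicity criterion
  have hcyc : ∀ y : G, y ^ (2 ^ m) ≠ 1 → IsCyclic G := by
    intro y hy
    have hdvd : orderOf y ∣ 2 ^ (m + 1) := hcard ▸ orderOf_dvd_natCard y
    obtain ⟨j, hj, hjy⟩ := (Nat.dvd_prime_pow Nat.prime_two).1 hdvd
    rcases Nat.lt_or_ge j (m + 1) with hjm | hjm
    · exfalso
      apply hy
      exact orderOf_dvd_iff_pow_eq_one.1 (hjy ▸ pow_dvd_pow 2 (by omega))
    · have hjm' : j = m + 1 := le_antisymm hj hjm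
      exact isCyclic_of_orderOf_eq_card y (by rw [hjy, hjm', hcard])
  -- an element outside `A`; `x a x⁻¹ = aʳ`, `x² = aˢ` (`s < 2^m`)
  obtain ⟨x, hxA⟩ : ∃ x : G, x ∉ A := by
    by_contra h
    push Not at h
    have htop : A = ⊤ := (Subgroup.eq_top_iff' A).2 h
    rw [htop, Subgroup.index_top] at hidx
    norm_num at hidx
  obtain ⟨r, hr⟩ : ∃ r : ℕ, x * a * x⁻¹ = a ^ r := by
    have hmem : x * a * x⁻¹ ∈ A := hAn.conj_mem a (Subgroup.mem_zpowers a) x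
    rw [hA, ← mem_powers_iff_mem_zpowers, Submonoid.mem_powers_iff] at hmem
    obtain ⟨n, hn⟩ := hmem
    exact ⟨n, hn.symm⟩
  obtain ⟨s, hs, hslt⟩ : ∃ s : ℕ, x * x = a ^ s ∧ s < 2 ^ m := by
    have hmem : x * x ∈ A := Subgroup.mul_self_mem_of_index_two hidx x
    rw [hA, ← mem_powers_iff_mem_zpowers, Submonoid.mem_powers_iff] at hmem
    obtain ⟨n, hn⟩ := hmem
    refine ⟨n % 2 ^ m, ?_, Nat.mod_lt _ hpos⟩
    rw [← ha, pow_mod_orderOf, hn]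
  have hconj_pow : ∀ k : ℕ, x * a ^ k * x⁻¹ = (x * a * x⁻¹) ^ k := fun k => by
    rw [← MulAut.conj_apply, map_pow, MulAut.conj_apply]
  -- `x²` commutes with `x`, hence `x aˢ x⁻¹ = aˢ`
  have hxs : x * a ^ s * x⁻¹ = a ^ s := by rw [← hs]; group
  have hrr : a ^ (r * r) = a := by
    have h1 : x * (x * a * x⁻¹) * x⁻¹ = a ^ (r * r) := by rw [hr, hconj_pow, hr, ← pow_mul]
    have h2 : x * (x * a * x⁻¹) * x⁻¹ = a := by
      calc x * (x * a * x⁻¹) * x⁻¹ = (x * x) * a * (x * x)⁻¹ := by group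
        _ = a := by rw [hs, ← pow_succ, pow_succ', mul_inv_cancel_right]
    rw [← h1, h2]
  -- elements of `x A` are not in `A`
  have hxout : ∀ k : ℕ, x * a ^ k ∉ A := fun k h =>
    hxA (by simpa using A.mul_mem h (A.inv_mem (Subgroup.npow_mem_zpowers a k)))
  have hxout' : ∀ k : ℕ, x * (a ^ k)⁻¹ ∉ A := fun k h =>
    hxA (by simpa using A.mul_mem h (Subgroup.npow_mem_zpowers a k))
  -- CASE ANALYSIS on the action of `x`
  -- Case 1: `x` centralises `a`
  have case1 : x * a * x⁻¹ = a → IsCyclic G ∨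
      (2 ≤ m ∧ ∃ x : G, x ∉ Subgroup.zpowers a ∧ x * a * x⁻¹ = a⁻¹ ∧ x * x = a ^ (2 ^ (m - 1))) := by
    intro h1
    have hc : Commute x a := mul_inv_eq_iff_eq_mul.1 h1
    rcases Nat.even_or_odd s with ⟨s', hs'⟩ | ⟨s', hs'⟩
    · -- `s` even: `x a^{-s'}` is an involution outside `A`
      exfalso
      refine hout _ (hxout' s') ?_
      have hc' : Commute (a ^ s')⁻¹ x := (hc.pow_right s').inv_right.symm
      calc x * (a ^ s')⁻¹ * (x * (a ^ s')⁻¹) = x * ((a ^ s')⁻¹ * x) * (a ^ s')⁻¹ := by group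
        _ = x * (x * (a ^ s')⁻¹) * (a ^ s')⁻¹ := by rw [hc'.eq]
        _ = (x * x) * (a ^ s' * a ^ s')⁻¹ := by group
        _ = 1 := by rw [hs, hs', pow_add, mul_inv_cancel]
    · -- `s` odd: `x` has order `2^(m+1)`
      left
      refine hcyc x ?_
      rw [h2m, pow_mul, pow_two, hs, ← pow_mul, hs']
      rw [show (2 * s' + 1) * 2 ^ (m - 1) = 2 ^ m * s' + 2 ^ (m - 1) from by rw [h2m]; ring, pow_add, hapow, one_mul]
      exact hz1
  rcases conj_eq_or_of_orderOf_eq_two_pow hm ha hr hrr with h1 | h3 | ⟨hm3, h2 | h4⟩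
  · exact case1 h1
  · -- Case 3: `x` inverts `a`; then `x² ∈ {1, z}`
    have hss : a ^ (s + s) = 1 := by
      have h' : x * a ^ s * x⁻¹ = (a ^ s)⁻¹ := by rw [hconj_pow, h3, inv_pow]
      rw [hxs, eq_inv_iff_mul_eq_one, ← pow_add] at h'
      exact h'
    have hdvd : 2 ^ (m - 1) ∣ s := by
      have hd : orderOf a ∣ s + s := orderOf_dvd_of_pow_eq_one hss
      rw [ha, h2m, ← two_mul] at hd
      exact Nat.dvd_of_mul_dvd_mul_left (by norm_num) hd
    obtain ⟨c, hc⟩ := hdvd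
    have hc2 : c < 2 := by
      by_contra hc2
      push Not at hc2
      have : 2 ^ m ≤ s := by
        rw [hc, h2m, mul_comm 2]
        exact Nat.mul_le_mul_left _ hc2
      omega
    interval_cases c
    · -- `s = 0`: `x` is an involution outside `A`
      exfalso
      rw [mul_zero] at hc
      rw [hc, pow_zero] at hs
      exact hout x hxA hs
    · rw [mul_one] at hc
      rw [hc] at hs
      rcases Nat.lt_or_ge m 2 with hm1 | hm2
      · -- `m = 1`: `x` has order `4 = |G|`
        left
        refine hcyc x ?_
        have hm1' : m = 1 := by omega
        subst hm1'
        rw [pow_one, pow_two, hs]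
        exact hz1
      · exact Or.inr ⟨hm2, x, hxA, h3, hs⟩
  · -- Case 2 (`3 ≤ m`): `x a x⁻¹ = a z`; an involution `x a^{-j}` outside `A` exists
    exfalso
    -- notation: `P = 2^(m-2)`, `Q = 2^(m-3)`
    obtain ⟨Q, hQ⟩ : ∃ Q, 2 ^ (m - 3) = Q := ⟨_, rfl⟩
    have hP : 2 ^ (m - 2) = 2 * Q := by rw [← hQ, ← pow_succ', show m - 3 + 1 = m - 2 from by omega]
    have hP1 : 2 ^ (m - 1) = 2 * (2 * Q) := by rw [← hP, ← pow_succ', show m - 2 + 1 = m - 1 from by omega]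
    have hρ : x * a * x⁻¹ = a ^ (1 + 2 * (2 * Q)) := by rw [h2, pow_add, pow_one, hP1]
    -- `s` is even
    have hseven : 2 ∣ s := by
      have h' : x * a ^ s * x⁻¹ = a ^ s * a ^ (2 ^ (m - 1) * s) := by
        rw [hconj_pow, hρ, ← pow_mul, ← pow_add, hP1]
        ring_nf
      rw [hxs, left_eq_mul] at h'
      have hd : orderOf a ∣ 2 ^ (m - 1) * s := orderOf_dvd_of_pow_eq_one h'
      rw [ha, h2m, mul_comm 2] at hd
      exact Nat.dvd_of_mul_dvd_mul_left (by positivity) hd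
    obtain ⟨s', hs'⟩ := hseven
    -- the involution `y = x (a^j)⁻¹`, `j = s' (1 + P)`
    set j := s' * (1 + 2 * Q) with hj
    refine hout _ (hxout' j) ?_
    have hkey : a ^ s = a ^ ((1 + 2 * (2 * Q)) * j) * a ^ j := by
      rw [← pow_add, show (1 + 2 * (2 * Q)) * j + j = s + 2 ^ m * (s' * (1 + Q)) from by
        rw [hj, hs', h2m, hP1]; ring, pow_add, hapow, mul_one]
    calc x * (a ^ j)⁻¹ * (x * (a ^ j)⁻¹) = (x * a ^ j * x⁻¹)⁻¹ * (x * x) * (a ^ j)⁻¹ := by group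
      _ = (a ^ ((1 + 2 * (2 * Q)) * j))⁻¹ * (a ^ ((1 + 2 * (2 * Q)) * j) * a ^ j) * (a ^ j)⁻¹ := by
        rw [hconj_pow, hρ, ← pow_mul, hs, hkey]
      _ = 1 := by group
  · -- Case 4 (`3 ≤ m`): `x a x⁻¹ = a⁻¹ z`; then `x² ∈ {1, z}` and `x` or `x a` is an involution outside `A`
    exfalso
    obtain ⟨Q, hQ⟩ : ∃ Q, 2 ^ (m - 3) = Q := ⟨_, rfl⟩
    have hP : 2 ^ (m - 2) = 2 * Q := by rw [← hQ, ← pow_succ', show m - 3 + 1 = m - 2 from by omega]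
    have hP1 : 2 ^ (m - 1) = 2 * (2 * Q) := by rw [← hP, ← pow_succ', show m - 2 + 1 = m - 1 from by omega]
    have hcomm : Commute a⁻¹ (a ^ (2 ^ (m - 1))) := ((Commute.refl a).pow_right _).inv_left
    have hconjk : ∀ k : ℕ, x * a ^ k * x⁻¹ = (a ^ k)⁻¹ * a ^ (2 ^ (m - 1) * k) := fun k => by
      rw [hconj_pow, h4, hcomm.mul_pow, inv_pow, pow_mul]
    -- the square of `x a^k`
    have hsq : ∀ k : ℕ, x * a ^ k * (x * a ^ k) = a ^ (2 ^ (m - 1) * k + s) := by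
      intro k
      calc x * a ^ k * (x * a ^ k) = (x * a ^ k * x⁻¹) * (x * x) * a ^ k := by group
        _ = (a ^ k)⁻¹ * a ^ (2 ^ (m - 1) * k) * a ^ s * a ^ k := by rw [hconjk, hs]
        _ = (a ^ k)⁻¹ * (a ^ (2 ^ (m - 1) * k) * a ^ s * a ^ k) := by group
        _ = (a ^ k)⁻¹ * (a ^ k * (a ^ (2 ^ (m - 1) * k) * a ^ s)) := by
          rw [← pow_add, ← pow_add, show 2 ^ (m - 1) * k + s + k = k + (2 ^ (m - 1) * k + s) by ring, pow_add,
            pow_add]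
        _ = a ^ (2 ^ (m - 1) * k + s) := by rw [inv_mul_cancel_left, pow_add]
    -- `2P ∣ s`, from `x aˢ x⁻¹ = aˢ`
    have h2Ps : 2 ^ (m - 1) ∣ s := by
      have h' : a ^ (2 ^ (m - 1) * s) = a ^ (s + s) := by
        have h'' := hconjk s
        rw [hxs, eq_inv_mul_iff_mul_eq, ← pow_add] at h''
        exact h''.symm
      rw [pow_eq_pow_iff_modEq, ha, h2m, hP1] at h'
      -- `4Q·s ≡ 2s (mod 8Q)` ⟹ `4Q ∣ s`
      have hd := h'.dvd
      push_cast at hd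
      have hd' : (2 * (2 * (2 * (Q : ℤ)))) ∣ 2 * (s * (1 - 2 * Q)) := by
        have : ((s : ℤ) + s - 2 * (2 * Q) * s) = 2 * (s * (1 - 2 * Q)) := by ring
        rwa [this] at hd
      have hd'' : (2 * (2 * (Q : ℤ))) ∣ s * (1 - 2 * Q) := (mul_dvd_mul_iff_left (by norm_num)).1 hd'
      have hcop : IsCoprime (2 * (2 * (Q : ℤ))) (1 - 2 * Q) := ⟨Q, 1 + 2 * Q, by ring⟩
      have hd3 : (2 * (2 * (Q : ℤ))) ∣ (s : ℤ) := hcop.dvd_of_dvd_mul_right hd''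
      rw [hP1]
      exact_mod_cast hd3
    obtain ⟨c, hc⟩ := h2Ps
    have hc2 : c < 2 := by
      by_contra hc2
      push Not at hc2
      have : 2 ^ m ≤ s := by
        rw [hc, h2m, mul_comm 2]
        exact Nat.mul_le_mul_left _ hc2
      omega
    interval_cases c
    · rw [mul_zero] at hc
      rw [hc, pow_zero] at hs
      exact hout x hxA hs
    · rw [mul_one] at hc
      refine hout _ (hxout 1) ?_
      have h1 := hsq 1
      rw [mul_one, hc, ← two_mul, ← h2m, ← ha, pow_orderOf_eq_one] at h1
      exact h1

end Literature.GroupTheory.UniqueInvolution
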